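import Summits.BirchSwinnertonDyer.Rank1Residual.GaloisImage.PrimeToPDescentH1
import Literature.NumberTheory.EllipticCurves.SubgroupSelmerCocycleCriteriaProofs
import Literature.NumberTheory.GaloisRepresentations.EulerSystem
import HarnessLib

/-!
# Route `ThetaPartnerAtTwo` (TP2), crux K2R0P♭ (stmt-BirchSwinnertonDyer-26471; derived node K2r0P 24945), line `rankzero` v19,
# stub `stub_poitouTateDeepTwoGen` = (S_PT) — brick B5a′ of `Cruxes/SignedMainConjectureCMTwoRankZeroOfPub/PT-DEEP-HALF-DESIGN-w2g4.md`
# §6: **restriction to a PRO-prime-to-`p` co-subgroup is injective on `H¹` with `p`-primary discrete coefficients**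
# (the tool behind «unramified ⟹ locally trivial over `ℚ_∞` at `w ∤ p`»: `Gal(ℚ_w^nr/ℚ_{∞,w}) ≅ ∏_{ℓ ≠ p} ℤ_ℓ`)

HONEST FRAMING (cell `pub/bsd-wall`, W-ALL row 1; width seat `bsd-wall-tp2-p2-w2` g4, `--supports` only). THEOREMS ONLY (no definition, no named
fact, no instance, no `sorry`); a TOOL theorem of continuous group cohomology in the tree's `subgroupH1` / `resOfLe` model; closes no item;
BSD is NOT proved by any of this.

## What is proved

Let `G` be a compact topological group acting on a discrete `p`-primary module `M` with continuous (= open-stabiliser) action, and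
`A ≤ B ≤ G` subgroups with `B` closed. The tree has the FINITE statement (`Rank1Residual.GaloisImage.resOfLe_injective_of_coprime_of_isClosed`,
cell b2b-bsdres): if `A` is open in `B` of index prime to `p` then `res : H¹(B, M) → H¹(A, M)` is injective. This file proves the PROFINITE version:

* `resOfLe_injective_of_forall_isOpen_coprime` — IF every subgroup `Z` with `A ≤ Z ≤ B` that is open in `B` has index `[B : Z]` prime to `p`
  (i.e. «`B/A` is pro-prime-to-`p`»), THEN `res : H¹(B, M) → H¹(A, M)` is injective.
  Proof: a class `x` with `res x = 0` has a cocycle `ψ` that is principal on `A`, `ψ|_A = ∂m`; the agreement locus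
  `Z = {b ∈ B | ψ(b) = b•m − m}` is a SUBGROUP (the difference of two crossed homomorphisms is one) which is OPEN in `B` (`ψ` continuous, `M` discrete,
  stabilisers open) and contains `A`; `res_{B→Z} x = 0` (principal on `Z`); by hypothesis `[B : Z]` is prime to `p`, so the finite statement gives `x = 0`.
  No cohomology of the quotient, no passage to the limit is used.

Intended use (B5b of the memo): `B = D_∞ = Gal(ℚ̄_w/ℚ_{∞,w})` (the local subgroup of `Γ_∞` at `w ∤ p` along the CYCLOTOMIC tower — no finite place splits
completely), `A = D_∞ ⊓ I_𝔐`; `D_∞/I_𝔐 ≅ ∏_{ℓ≠p} ℤ_ℓ` has every open subgroup of index prime to `p` (brick B5a″), so an `E[p^∞]`-class over `ℚ_∞` unramified at `w`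
is locally trivial at `w` (Greenberg, LNM 1716, §2: "`Gal((K_∞)_η^{unr}/(K_∞)_η)` has profinite order prime to `p`"), after which Greenberg's Lemma 3.3 (tree:
`Greenberg1999.localTowerKerPrimary_eq_bot_of_hasGoodReductionAt`) descends local triviality to every layer.

References: [SerreGaloisCohomology1997] I §2.4 (restriction/corestriction), I §5.1 (principal crossed homomorphisms); [GreenbergLNM1716] §2 (p. 70), §5 (p. 143).
-/

set_option autoImplicit false
-- the Theorems namespace of this sub repeats the summit name by design (D-0017 nested layout)
set_option linter.dupNamespace false

noncomputable section

open scoped Classical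

universe u

namespace Summit.BirchSwinnertonDyer.BirchSwinnertonDyer.Theorems

namespace SignedLowerOffTwo.PTDeep

open Literature.NumberTheory.EllipticCurves Literature.NumberTheory.GaloisRepresentations
  Summit.BirchSwinnertonDyer.Rank1Residual.GaloisImage

variable {G : Type u} [Group G] [TopologicalSpace G] [IsTopologicalGroup G]
variable {A B : Subgroup G}
variable (M : Type u) [AddCommGroup M] [DistribMulAction G M] [TopologicalSpace M] [DiscreteTopology M]
variable {p : ℕ}

/-- **Restriction to a pro-prime-to-`p` co-subgroup is injective on `H¹` (`p`-primary discrete coefficients).** `G` compact, `B ≤ G` closed,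
`A ≤ B`, the action on the discrete `p`-primary module `M` continuous; if every subgroup `Z`, `A ≤ Z ≤ B`, open in `B` has `[B : Z]` prime to `p`,
then `res : H¹(B, M) → H¹(A, M)` is injective. (The agreement locus of a cocycle with a principal one is an open subgroup; then the tree's finite
statement `resOfLe_injective_of_coprime_of_isClosed`.) [cite: SerreGaloisCohomology1997, I §2.4 and I §5.1] [cite: GreenbergLNM1716, §2 (p. 70) and §5 (p. 143)] -/
theorem resOfLe_injective_of_forall_isOpen_coprime [CompactSpace G] [ContinuousSMul G M] (h : A ≤ B)
    (hBc : IsClosed (B : Set G)) (hM : ∀ m : M, ∃ k : ℕ, p ^ k • m = 0)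
    (hcop : ∀ Z : Subgroup G, A ≤ Z → (hZB : Z ≤ B) → IsOpen (Z.subgroupOf B : Set B) → (Z.relIndex B).Coprime p) :
    Function.Injective (resOfLe M h : subgroupH1 B M → subgroupH1 A M) := by
  -- it suffices to show that the kernel is trivial
  refine (injective_iff_map_eq_zero _).mpr fun x hx ↦ ?_
  obtain ⟨ψ, rfl⟩ := oneCocycleClass_surjective (discreteTopRep B M) x
  -- `ψ` is principal on `A`
  obtain ⟨m, hm⟩ := (CocycleCriteria.resOfLe_oneCocycleClass_eq_zero_iff (M := M) h ψ).mp hx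
  -- the agreement locus `Z = {b ∈ B | ψ b = b • m - m}`, an open subgroup of `B` containing `A`
  have hρ : ∀ (b : B) (v : M), (discreteTopRep B M).ρ b v = (b : G) • v := fun _ _ ↦ rfl
  have hmul : ∀ b b' : B, ψ.1 b = (b : G) • m - m → ψ.1 b' = (b' : G) • m - m →
      ψ.1 (b * b') = ((b * b' : B) : G) • m - m := fun b b' hb hb' ↦ by
    rw [ψ.2 b b', hb, hρ, hb', smul_sub, Subgroup.coe_mul, mul_smul]
    abel
  have hone : ψ.1 1 = ((1 : B) : G) • m - m := by
    rw [contOneCocycles.apply_one, Subgroup.coe_one, one_smul, sub_self]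
  have hinv : ∀ b : B, ψ.1 b = (b : G) • m - m → ψ.1 b⁻¹ = ((b⁻¹ : B) : G) • m - m := fun b hb ↦ by
    have h1 := ψ.2 b⁻¹ b
    rw [inv_mul_cancel, contOneCocycles.apply_one, hρ, hb, smul_sub, Subgroup.coe_inv, ← mul_smul,
      inv_mul_cancel, one_smul] at h1
    -- `h1 : 0 = ψ b⁻¹ + (m - b⁻¹ • m)`
    rw [Subgroup.coe_inv, eq_neg_of_add_eq_zero_left h1.symm, neg_sub]
  let Z : Subgroup G :=
    { carrier := {g | ∃ hg : g ∈ B, ψ.1 ⟨g, hg⟩ = g • m - m}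
      one_mem' := ⟨B.one_mem, hone⟩
      mul_mem' := by
        rintro g g' ⟨hg, hψg⟩ ⟨hg', hψg'⟩
        exact ⟨B.mul_mem hg hg', hmul ⟨g, hg⟩ ⟨g', hg'⟩ hψg hψg'⟩
      inv_mem' := by
        rintro g ⟨hg, hψg⟩
        exact ⟨B.inv_mem hg, hinv ⟨g, hg⟩ hψg⟩ }
  have hZmem : ∀ g : G, g ∈ Z ↔ ∃ hg : g ∈ B, ψ.1 ⟨g, hg⟩ = g • m - m := fun _ ↦ Iff.rfl
  have hAZ : A ≤ Z := fun a ha ↦ (hZmem a).mpr ⟨h ha, hm ⟨a, ha⟩⟩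
  have hZB : Z ≤ B := fun g hg ↦ ((hZmem g).mp hg).1
  -- `Z` is open in `B`
  have hZopen : IsOpen (Z.subgroupOf B : Set B) := by
    have hset : (Z.subgroupOf B : Set B) = (fun b : B ↦ ψ.1 b - ((b : G) • m - m)) ⁻¹' {0} := by
      ext b
      simp only [SetLike.mem_coe, Subgroup.mem_subgroupOf, Set.mem_preimage, Set.mem_singleton_iff, sub_eq_zero]
      exact ⟨fun ⟨_, hb⟩ ↦ hb, fun hb ↦ ⟨b.2, hb⟩⟩
    rw [hset]
    refine (isOpen_discrete _).preimage ?_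
    exact ψ.1.continuous.sub ((continuous_subtype_val.smul continuous_const).sub continuous_const)
  -- `Z` has finite index in the compact group `B`
  haveI : CompactSpace B := isCompact_iff_compactSpace.mp hBc.isCompact
  haveI : (Z.subgroupOf B).FiniteIndex := finiteIndex_of_isOpen_of_compactSpace _ hZopen
  -- `res_{B → Z} [ψ] = 0`: `ψ` is principal on `Z`
  have hresZ : resOfLe M hZB (oneCocycleClass (discreteTopRep B M) ψ) = 0 :=
    (CocycleCriteria.resOfLe_oneCocycleClass_eq_zero_iff (M := M) hZB ψ).mpr ⟨m, fun z ↦ ((hZmem z.1).mp z.2).2⟩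
  -- the finite prime-to-`p` statement
  have hinj := resOfLe_injective_of_coprime_of_isClosed M hZB hZopen hBc hM (hcop Z hAZ hZB hZopen)
  exact hinj (by rw [hresZ, map_zero])

/-- **The same with the hypothesis on the OPEN SUBGROUPS OF `G` containing `A`** (the form an arithmetic index computation delivers, e.g. for
`B = D_∞`, `A = I_𝔐` inside `G = Γ_{K_v}`): `G` profinite (compact, totally disconnected); if every open subgroup `W ≥ A` of `G` has
`[B : W ⊓ B]` prime to `p`, then `res : H¹(B, M) → H¹(A, M)` is injective. Reduction to `resOfLe_injective_of_forall_isOpen_coprime`: a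
subgroup `Z`, `A ≤ Z ≤ B`, open in `B` contains `B ⊓ (A ⊔ U₀)` for an open normal subgroup `U₀` of `G`
(`ProfiniteGrp.exist_openNormalSubgroup_sub_open_nhds_of_one`), and `[B : Z] ∣ [B : (A ⊔ U₀) ⊓ B]`.
[cite: SerreGaloisCohomology1997, I §2.4] [cite: GreenbergLNM1716, §2 (p. 70)] -/
theorem resOfLe_injective_of_forall_isOpen_sup_coprime [CompactSpace G] [TotallyDisconnectedSpace G] [ContinuousSMul G M]
    (h : A ≤ B) (hBc : IsClosed (B : Set G)) (hM : ∀ m : M, ∃ k : ℕ, p ^ k • m = 0)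
    (hcop : ∀ W : Subgroup G, A ≤ W → IsOpen (W : Set G) → ((W ⊓ B).relIndex B).Coprime p) :
    Function.Injective (resOfLe M h : subgroupH1 B M → subgroupH1 A M) := by
  refine resOfLe_injective_of_forall_isOpen_coprime M h hBc hM fun Z hAZ hZB hZopen ↦ ?_
  -- `Z ⊇ B ⊓ U₀` for an open normal subgroup `U₀` of `G`
  obtain ⟨O, hO, hOZ⟩ := isOpen_induced_iff.mp hZopen
  have h1O : (1 : G) ∈ O := by
    have h1 : (1 : B) ∈ (Subtype.val ⁻¹' O : Set B) := by rw [hOZ]; exact one_mem _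
    exact h1
  obtain ⟨U₀, hU₀⟩ := ProfiniteGrp.exist_openNormalSubgroup_sub_open_nhds_of_one hO h1O
  -- `W := A ⊔ U₀` is open, contains `A`, and `W ⊓ B ≤ Z`
  have hWopen : IsOpen ((A ⊔ (U₀ : Subgroup G) : Subgroup G) : Set G) :=
    Subgroup.isOpen_mono le_sup_right U₀.isOpen
  have hWB : (A ⊔ (U₀ : Subgroup G)) ⊓ B ≤ Z := by
    intro g hg
    obtain ⟨hgW, hgB⟩ := Subgroup.mem_inf.mp hg
    have hg' : (g : G) ∈ ((A ⊔ (U₀ : Subgroup G) : Subgroup G) : Set G) := hgW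
    rw [Subgroup.mul_normal] at hg'
    obtain ⟨a, ha, u, hu, rfl⟩ := Set.mem_mul.mp hg'
    have huB : u ∈ B := by
      have := B.mul_mem (B.inv_mem (h ha)) hgB
      rwa [inv_mul_cancel_left] at this
    have huZ : u ∈ Z := by
      have hu' : (⟨u, huB⟩ : B) ∈ (Subtype.val ⁻¹' O : Set B) := hU₀ hu
      rw [hOZ] at hu'
      exact Subgroup.mem_subgroupOf.mp hu'
    exact Z.mul_mem (hAZ ha) huZ
  exact Nat.Coprime.coprime_dvd_left (Subgroup.relIndex_dvd_of_le_left B hWB) (hcop _ le_sup_left hWopen)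

/-- Transport of injectivity of a restriction map `res : H¹(B, M) → H¹(A, M)` along equalities `A₁ = A₂`, `B₁ = B₂` of the two subgroups
(used to pass between `r(D_∞)`, `r(I_𝔐)` and their descriptions `Gal(K̄/K_∞) ⊓ D_v`, `Gal(K̄/K_∞) ⊓ r(I_𝔐)` inside `Γ_K`). [folklore] -/
theorem resOfLe_injective_congr {A₁ A₂ B₁ B₂ : Subgroup G} (hA : A₁ = A₂) (hB : B₁ = B₂) (h₁ : A₁ ≤ B₁) (h₂ : A₂ ≤ B₂)
    (hinj : Function.Injective (resOfLe M h₁ : subgroupH1 B₁ M → subgroupH1 A₁ M)) :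
    Function.Injective (resOfLe M h₂ : subgroupH1 B₂ M → subgroupH1 A₂ M) := by
  subst hA hB
  exact hinj

end SignedLowerOffTwo.PTDeep

end Summit.BirchSwinnertonDyer.BirchSwinnertonDyer.Theorems

end
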